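import Mathlib
import HarnessLib
import Literature.MathematicalPhysics.KineticTheory.HardSphereEulerProofs
import Literature.Analysis.FluidPDE.CollisionalTransfer
import Summits.AtomisticToContinuum.HydrodynamicLimit.Theses.OneFlightGossipEngine
import Summits.AtomisticToContinuum.HydrodynamicLimit.Theorems.OneFlightGossipEngineKineticCurrentsWindowLDUniformWindowRenyiOfTransportPrelim
import Summits.AtomisticToContinuum.HydrodynamicLimit.Theorems.OneFlightGossipEngineKineticCurrentsWindowLDApriori

/-!
# Displacement half of the kinetic-window transport tightness — preliminaries (registered helper
# `stub_displacementTightness_prelim` of line `Sketch`, crux `KineticCurrentsLDAlongFamilies`,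
# stmt-AtomisticToContinuum-16659)

Route `OneFlightGossipEngine`, sub-problem `HydrodynamicLimit`. Statics and the pathwise bound for the stub
S2''a `stub_displacementTightnessFamily` (file `…KineticCurrentsLDAlongFamiliesDisplacementTightness.lean`):
a linear modulus along a jointly continuous family on `[0,t₁] × 𝕋³`, the vanishing of the kinetic window,
the truncated one-particle Gaussian moment `∫ e^{αe + β(e−V)⁺} dN(u,θ) ≤ Ĝ(α) + e^{−βV}Ĝ(α+β)`, and the
pathwise bound on good orbits
`|Σᵢ (ϑ(xᵢ(r)) − ϑ(xᵢ(0)))‖vᵢ(0)‖²/2| ≤ ωV·n + CV·(r·n + 2rE(z)) + 2B·Σᵢ(‖vᵢ(0)‖²/2 − V)⁺`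
(truncation of the initial energies at level `V`, path bound `dist(xᵢ(r),xᵢ(0)) ≤ ∫₀ʳ‖vᵢ‖ ≤ ∫₀ʳ(1+‖vᵢ‖²)`,
energy conservation `Σᵢ∫₀ʳ‖vᵢ‖² = 2rE`).

References: S. Olla, S. R. S. Varadhan, H.-T. Yau, Comm. Math. Phys. 155 (1993) §2; H. Spohn, *Large Scale
Dynamics of Interacting Particles* (1991), Part I §2.3.
-/

noncomputable section

open MeasureTheory Set Filter
open scoped ENNReal Topology InnerProductSpace

namespace Summit.AtomisticToContinuum.HydrodynamicLimit.Theorems.KineticCurrentsLDAlongFamiliesSketch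

open Literature.Analysis.FluidPDE (HardSphereFlow Config localMaxwellian canonicalDensity liouville
  hardSphereDomain configEnergy)
open Literature.MathematicalPhysics.KineticTheory (T3 V3 hsDiameter localGibbsLaw localGibbsMeasure
  localGibbsProfile)
open Literature.Analysis.FluidPDE Literature.MathematicalPhysics.KineticTheory

/-! ### Statics: a linear family modulus, the window threshold, the fibre bound -/

/-- **Linear modulus along a jointly continuous family.** For `g` jointly continuous on `ℝ × 𝕋³`,
`t₁` and `ω > 0` there is ONE `C ≥ 0` with `|g s x − g s y| ≤ ω + C·dist_{𝕋³}(x, y)` for all `s ∈ [0,t₁]`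
(Heine–Cantor and boundedness on the compact `[0,t₁] × 𝕋³`; far pairs are paid by `2B ≤ (2B/ℓ)·dist`).
[folklore] -/
theorem wdt_abs_sub_le_lin_family {g : ℝ → T3 → ℝ} (hg : Continuous (Function.uncurry g)) (t₁ : ℝ)
    {ω : ℝ} (hω : 0 < ω) :
    ∃ C : ℝ, 0 ≤ C ∧ ∀ s ∈ Icc 0 t₁, ∀ x y : T3,
      |g s x - g s y| ≤ ω + C * Torus.euclidDist x y := by
  have hK : IsCompact (Icc (0 : ℝ) t₁ ×ˢ (univ : Set T3)) := isCompact_Icc.prod isCompact_univ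
  obtain ⟨B₀, hB₀⟩ := hK.exists_bound_of_continuousOn hg.continuousOn
  obtain ⟨ℓ, hℓ, huc⟩ := Metric.uniformContinuousOn_iff.1
    (hK.uniformContinuousOn_of_continuous hg.continuousOn) ω hω
  have hB : ∀ s ∈ Icc (0 : ℝ) t₁, ∀ z : T3, |g s z| ≤ max B₀ 0 := fun s hs z => by
    have h := hB₀ (s, z) (Set.mk_mem_prod hs (mem_univ _))
    rw [Real.norm_eq_abs, Function.uncurry_apply_pair] at h
    exact h.trans (le_max_left _ _)
  refine ⟨2 * max B₀ 0 / ℓ, by positivity, fun s hs x y => ?_⟩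
  have hmem : ∀ z : T3, (s, z) ∈ Icc (0 : ℝ) t₁ ×ˢ (univ : Set T3) := fun z =>
    Set.mk_mem_prod hs (mem_univ _)
  have hd0 : 0 ≤ Torus.euclidDist x y := norm_nonneg _
  have hnn : 0 ≤ 2 * max B₀ 0 / ℓ * Torus.euclidDist x y := by positivity
  by_cases hd : Torus.euclidDist x y < ℓ
  · have hxy : dist ((s, x) : ℝ × T3) (s, y) < ℓ := by
      rw [Prod.dist_eq, dist_self, max_eq_right dist_nonneg, dist_eq_norm]
      exact (Torus.norm_sub_le_euclidDist_holds x y).trans_lt hd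
    have h := huc _ (hmem x) _ (hmem y) hxy
    rw [Real.dist_eq, Function.uncurry_apply_pair, Function.uncurry_apply_pair] at h
    linarith [h.le]
  · rw [not_lt] at hd
    have h1 : |g s x - g s y| ≤ 2 * max B₀ 0 := by
      have := abs_sub (g s x) (g s y)
      linarith [hB s hs x, hB s hs y]
    have h2 : 2 * max B₀ 0 ≤ 2 * max B₀ 0 / ℓ * Torus.euclidDist x y := by
      rw [div_mul_eq_mul_div, le_div_iff₀ hℓ]
      exact mul_le_mul_of_nonneg_left hd (by positivity)
    linarith

/-- The kinetic window `w_N = τ (N+1)^{-1/3}` tends to `0`: `c · w_N < γ` eventually. [folklore] -/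
theorem wdt_exists_N0 (τ c : ℝ) {γ : ℝ} (hγ : 0 < γ) :
    ∃ N₀ : ℕ, ∀ N : ℕ, N₀ ≤ N → c * (τ * ((N : ℝ) + 1) ^ (-(1 / 3 : ℝ))) < γ := by
  have h1 : Tendsto (fun N : ℕ => τ * ((N : ℝ) + 1) ^ (-(1 / 3 : ℝ))) atTop (𝓝 (τ * 0)) :=
    ((tendsto_rpow_neg_atTop (by norm_num : (0 : ℝ) < 1 / 3)).comp
      (tendsto_atTop_add_const_right atTop 1 tendsto_natCast_atTop_atTop)).const_mul τ
  have h2 : Tendsto (fun N : ℕ => c * (τ * ((N : ℝ) + 1) ^ (-(1 / 3 : ℝ)))) atTop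
      (𝓝 (c * (τ * 0))) := h1.const_mul c
  rw [mul_zero, mul_zero] at h2
  exact eventually_atTop.1 (h2.eventually (gt_mem_nhds hγ))

/-- **One-particle truncated Gaussian moment.** For `θ > 0`, `0 ≤ α`, `0 ≤ β`, `2(α+β)θ < 1` and any
level `V`: `∫ exp(α‖v‖²/2 + β·max 0 (‖v‖²/2 − V)) dN(u,θ) ≤ Ĝ(α) + e^{−βV}·Ĝ(α+β)` with
`Ĝ(γ) = e^{γ‖u‖²}(1 − 2γθ)^{-3/2}` (split at `‖v‖²/2 ≤ V`: below the level the tail factor is `1`, above it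
is `e^{β‖v‖²/2}e^{−βV}`). [folklore] -/
theorem wdt_fibre_trunc_moment_le {θ α β : ℝ} (hθ : 0 < θ) (hα : 0 ≤ α) (hβ : 0 ≤ β)
    (hs : 2 * (α + β) * θ < 1) (u : V3) (V : ℝ) :
    ∫⁻ v, ENNReal.ofReal (Real.exp (α * (‖v‖ ^ 2 / 2) + β * max 0 (‖v‖ ^ 2 / 2 - V)))
        ∂gaussMeasure u θ ≤
      ENNReal.ofReal (Real.exp (α * ‖u‖ ^ 2) * (1 - 2 * α * θ) ^ (-(3 : ℝ) / 2)) +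
        ENNReal.ofReal (Real.exp (-(β * V))) *
          ENNReal.ofReal (Real.exp ((α + β) * ‖u‖ ^ 2) * (1 - 2 * (α + β) * θ) ^ (-(3 : ℝ) / 2)) := by
  have hαs : 2 * α * θ < 1 := by nlinarith
  -- pointwise split
  have hpt : ∀ v : V3, Real.exp (α * (‖v‖ ^ 2 / 2) + β * max 0 (‖v‖ ^ 2 / 2 - V)) ≤
      Real.exp (α * (‖v‖ ^ 2 / 2)) +
        Real.exp (-(β * V)) * Real.exp ((α + β) * (‖v‖ ^ 2 / 2)) := by
    intro v
    rcases le_total (‖v‖ ^ 2 / 2 - V) 0 with h | h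
    · rw [max_eq_left h, mul_zero, add_zero]
      exact le_add_of_nonneg_right (by positivity)
    · rw [max_eq_right h, ← Real.exp_add]
      have : α * (‖v‖ ^ 2 / 2) + β * (‖v‖ ^ 2 / 2 - V) = -(β * V) + (α + β) * (‖v‖ ^ 2 / 2) := by
        ring
      rw [this]
      exact le_add_of_nonneg_left (Real.exp_nonneg _)
  have hm1 : Measurable fun v : V3 => ENNReal.ofReal (Real.exp (α * (‖v‖ ^ 2 / 2))) := by fun_prop
  calc ∫⁻ v, ENNReal.ofReal (Real.exp (α * (‖v‖ ^ 2 / 2) + β * max 0 (‖v‖ ^ 2 / 2 - V)))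
        ∂gaussMeasure u θ
      ≤ ∫⁻ v, (ENNReal.ofReal (Real.exp (α * (‖v‖ ^ 2 / 2))) +
          ENNReal.ofReal (Real.exp (-(β * V))) *
            ENNReal.ofReal (Real.exp ((α + β) * (‖v‖ ^ 2 / 2)))) ∂gaussMeasure u θ := by
        refine lintegral_mono fun v => ?_
        rw [← ENNReal.ofReal_mul (Real.exp_nonneg _),
          ← ENNReal.ofReal_add (Real.exp_nonneg _) (by positivity)]
        exact ENNReal.ofReal_le_ofReal (hpt v)
    _ = (∫⁻ v, ENNReal.ofReal (Real.exp (α * (‖v‖ ^ 2 / 2))) ∂gaussMeasure u θ) +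
          ENNReal.ofReal (Real.exp (-(β * V))) *
            ∫⁻ v, ENNReal.ofReal (Real.exp ((α + β) * (‖v‖ ^ 2 / 2))) ∂gaussMeasure u θ := by
        rw [lintegral_add_left hm1, lintegral_const_mul' _ _ ENNReal.ofReal_ne_top]
    _ ≤ _ := by
        have h₁ := lintegral_exp_mul_norm_sq_gaussMeasure_le (E := V3) hθ hα hαs u
        have h₂ := lintegral_exp_mul_norm_sq_gaussMeasure_le (E := V3) hθ (add_nonneg hα hβ) hs u
        simp only [finrank_euclideanSpace_fin, Nat.cast_ofNat] at h₁ h₂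
        exact add_le_add h₁ (mul_le_mul_right h₂ _)

/-! ### The pathwise bound on good orbits -/

/-- **Displacement part of `ΔE_ϑ` along a good orbit (registered helper `stub_displacementTightness_prelim`).** If `|ϑ x − ϑ y| ≤ ω + C·dist(x,y)`, `|ϑ| ≤ B`,
`0 ≤ V` and `0 ≤ r`, then on the good set
`|Σᵢ (ϑ(xᵢ(r)) − ϑ(xᵢ(0)))·‖vᵢ(0)‖²/2| ≤ ωV·n + CV·(r·n + 2rE(z)) + 2B·Σᵢ max 0 (‖vᵢ(0)‖²/2 − V)`
(truncation `e ≤ V + (e − V)⁺`, the path bound `dist(xᵢ(r),xᵢ(0)) ≤ ∫₀ʳ‖vᵢ‖ ≤ ∫₀ʳ(1 + ‖vᵢ‖²)`, and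
`Σᵢ∫₀ʳ‖vᵢ‖² = 2rE`). [folklore] -/
theorem stub_displacementTightness_prelim :
    ∀ {ε : ℝ} {n : ℕ} (Φ : HardSphereFlow (Literature.Analysis.FluidPDE.Torus.geometry (Fin 3)) ε n)
      {z : Config n (Fin 3) T3}, z ∈ Φ.good → ∀ {ϑ : T3 → ℝ} {ω C B V r : ℝ}, 0 ≤ C →
      (∀ x y : T3, |ϑ x - ϑ y| ≤ ω + C * Torus.euclidDist x y) → (∀ x, |ϑ x| ≤ B) →
      0 ≤ V → 0 ≤ r →
      |∑ i, (ϑ (Φ.flow r z i).1 - ϑ (z i).1) * (‖(z i).2‖ ^ 2 / 2)| ≤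
        ω * V * n + C * V * (r * n + 2 * r * configEnergy z) +
          2 * B * ∑ i, max 0 (‖(z i).2‖ ^ 2 / 2 - V) := by
  intro ε n Φ z hz ϑ ω C B V r hC hmod hB hV hr
  obtain ⟨hint2, hsum⟩ := sum_window_integral_norm_sq_eq Φ hz r
  have hγm : Measurable fun t => Φ.flow t z := (Φ.isTrajectory z hz).measurable_torus
  have hint1 : ∀ i, IntervalIntegrable (fun s => ‖(Φ.flow s z i).2‖) volume 0 r := fun i =>
    (intervalIntegrable_const (c := Real.sqrt (2 * configEnergy z))).mono_fun'
      ((measurable_pi_apply i).comp hγm).snd.norm.aestronglyMeasurable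
      (ae_of_all _ fun s => by simpa only [norm_norm] using Φ.norm_vel_flow_le hz s i)
  -- the displacement of particle `i` is at most `r + ∫₀ʳ ‖vᵢ‖²`
  have hdi : ∀ i, Torus.euclidDist (Φ.flow r z i).1 (z i).1 ≤
      r + ∫ s in (0 : ℝ)..r, ‖(Φ.flow s z i).2‖ ^ 2 := by
    intro i
    refine (ShearStressHalfDrudeDisplacement.euclidDist_flow_le_integral_norm_vel Φ hz i hr).trans ?_
    have hmono : ∫ s in (0 : ℝ)..r, ‖(Φ.flow s z i).2‖ ≤
        ∫ s in (0 : ℝ)..r, (1 + ‖(Φ.flow s z i).2‖ ^ 2) :=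
      intervalIntegral.integral_mono_on hr (hint1 i) ((intervalIntegrable_const).add (hint2 i))
        fun s _ => by nlinarith [sq_nonneg (‖(Φ.flow s z i).2‖ - 1), norm_nonneg (Φ.flow s z i).2]
    refine hmono.trans_eq ?_
    rw [intervalIntegral.integral_add intervalIntegrable_const (hint2 i),
      intervalIntegral.integral_const, sub_zero, smul_eq_mul, mul_one]
  -- sum of the displacements
  have hdsum : ∑ i, Torus.euclidDist (Φ.flow r z i).1 (z i).1 ≤ r * n + 2 * r * configEnergy z := by
    calc ∑ i, Torus.euclidDist (Φ.flow r z i).1 (z i).1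
        ≤ ∑ i, (r + ∫ s in (0 : ℝ)..r, ‖(Φ.flow s z i).2‖ ^ 2) := Finset.sum_le_sum fun i _ => hdi i
      _ = r * n + 2 * r * configEnergy z := by
          rw [Finset.sum_add_distrib, Finset.sum_const, Finset.card_univ, Fintype.card_fin,
            nsmul_eq_mul, hsum]
          ring
  -- termwise truncation bound
  have hterm : ∀ i, |(ϑ (Φ.flow r z i).1 - ϑ (z i).1) * (‖(z i).2‖ ^ 2 / 2)| ≤
      (ω + C * Torus.euclidDist (Φ.flow r z i).1 (z i).1) * V +
        2 * B * max 0 (‖(z i).2‖ ^ 2 / 2 - V) := by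
    intro i
    set e : ℝ := ‖(z i).2‖ ^ 2 / 2 with he
    set Δ : ℝ := ϑ (Φ.flow r z i).1 - ϑ (z i).1 with hΔ
    have he0 : 0 ≤ e := by positivity
    have hm0 : 0 ≤ max 0 (e - V) := le_max_left _ _
    have heV : e ≤ V + max 0 (e - V) := by
      have := le_max_right 0 (e - V)
      linarith
    have hΔmod : |Δ| ≤ ω + C * Torus.euclidDist (Φ.flow r z i).1 (z i).1 := hmod _ _
    have hΔB : |Δ| ≤ 2 * B := by
      have h := abs_sub (ϑ (Φ.flow r z i).1) (ϑ (z i).1)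
      linarith [hB (Φ.flow r z i).1, hB (z i).1]
    rw [abs_mul, abs_of_nonneg he0]
    calc |Δ| * e ≤ |Δ| * (V + max 0 (e - V)) := mul_le_mul_of_nonneg_left heV (abs_nonneg _)
      _ = |Δ| * V + |Δ| * max 0 (e - V) := by ring
      _ ≤ (ω + C * Torus.euclidDist (Φ.flow r z i).1 (z i).1) * V + 2 * B * max 0 (e - V) :=
          add_le_add (mul_le_mul_of_nonneg_right hΔmod hV) (mul_le_mul_of_nonneg_right hΔB hm0)
  calc |∑ i, (ϑ (Φ.flow r z i).1 - ϑ (z i).1) * (‖(z i).2‖ ^ 2 / 2)|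
      ≤ ∑ i, |(ϑ (Φ.flow r z i).1 - ϑ (z i).1) * (‖(z i).2‖ ^ 2 / 2)| :=
        Finset.abs_sum_le_sum_abs _ _
    _ ≤ ∑ i, ((ω + C * Torus.euclidDist (Φ.flow r z i).1 (z i).1) * V +
          2 * B * max 0 (‖(z i).2‖ ^ 2 / 2 - V)) := Finset.sum_le_sum fun i _ => hterm i
    _ = ω * V * n + C * V * ∑ i, Torus.euclidDist (Φ.flow r z i).1 (z i).1 +
          2 * B * ∑ i, max 0 (‖(z i).2‖ ^ 2 / 2 - V) := by
        rw [Finset.sum_add_distrib, ← Finset.mul_sum]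
        have : ∑ i, (ω + C * Torus.euclidDist (Φ.flow r z i).1 (z i).1) * V =
            ω * V * n + C * V * ∑ i, Torus.euclidDist (Φ.flow r z i).1 (z i).1 := by
          simp_rw [add_mul]
          rw [Finset.sum_add_distrib, Finset.sum_const, Finset.card_univ, Fintype.card_fin,
            nsmul_eq_mul, Finset.mul_sum]
          congr 1
          · ring
          · exact Finset.sum_congr rfl fun i _ => by ring
        rw [this]
    _ ≤ ω * V * n + C * V * (r * n + 2 * r * configEnergy z) +
          2 * B * ∑ i, max 0 (‖(z i).2‖ ^ 2 / 2 - V) := by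
        have hCV : 0 ≤ C * V := mul_nonneg hC hV
        have h := mul_le_mul_of_nonneg_left hdsum hCV
        linarith

end Summit.AtomisticToContinuum.HydrodynamicLimit.Theorems.KineticCurrentsLDAlongFamiliesSketch

end
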